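import Summits.QuantumFields.YangMills.Theorems.BalabanUVNodesN07PointFeasibilityOneLevelSymbolBridge
import Literature.MathematicalPhysics.QuantumFieldTheory.Balaban1983to89.B5Eq135Momentum
import HarnessLib

/-!
# DAG node N07 [B11], road R0′ ∕ (L4) road v1 socket (S2-x) — THE ROBUST ONE-LEVEL INEQUALITY (R1L) IN x-SPACE:
# `|⟨β, S_{c₀}Δ⁻²r − Q′Δ⁻²r⟩| ≤ √C · ‖Δ⁻¹Q′ᴴβ‖ · ‖r‖` for every coarse `β ⊥ 1` and every fine `r`, FROM a displayed per-coarse-momentum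
# bound `Σ_l |e^{i(p′+l)ηc₀} − u(p′+l)|²∕Δ(p′+l)⁴ ≤ C·Σ_l |u(p′+l)|²∕Δ(p′+l)²` (Parseval on both tori + Cauchy–Schwarz in the alias index and in `p′`)

Cell `pub-ymgap` (HUMAN RULINGS D-0062 ∕ D-0149 ∕ D-0154), width seat `pub-ymgap-dag-n07-w5` g3, CLAIM-3 ∕ INTENT-3 cell bus 2026-08-28 (OFFER of dag-n07-w7 g6,
I.38186 ∕ `LOCATED-KPOS-MULTILEVEL.md` §3: «the x-space transfer … lives in YOUR framework»).  `--kind proof --supports stmt-QuantumFields-27364 --as helper`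
(K1⁹ per dag-lead KEY MAP v2; count-neutral).  THEOREMS ONLY.

THE PRINT.  [B5] = `[Balaban1984PropagatorsI]` CMP **95** (1984) 17–40: (1.20) p. 20 (`Q′_k`), (1.29)–(1.33) p. 23 (`p = p′ + l`, `u_k(p) = Π_μ ∂¹_μ(p′)∕∂_μ(p)`,
«Σ_l |u_k(p′+l)|²∕Δ²(p′+l)»); [B6] = `[Balaban1984PropagatorsII]` CMP **96** (1984) 223–250: (2.22) p. 226; [I] = `[Balaban1987RG1]` CMP **109** (1987) 249–301:
(0.4) p. 253 (the centre averaging, odd `L`).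

WHY (dag-n07-w7 g6's (L4) road v1, `LOCATED-KPOS-MULTILEVEL.md` §3–§4).  Localising the centre form `K − K₀ = −⟨f, Πz⟩` on the high-pass part `z = (1 − P)w` with a
block-constant partition of unity leaves, per bulk piece, the sharp one-level margin (S1, landed: p633313) plus ONE robust input: the pairing
`Y(β, r) := Σ_y conj β(y)·[(Δ⁻²r)(ny + c₀) − (Q′Δ⁻²r)(y)]` of a block density `β` against the CENTRE-MINUS-MEAN of `Δ⁻²` of a NON-block-constant residual
`r` (the commutator `[Δ², χ_a]w`), which must be controlled by `√K₀(β)·‖r‖` with an `M`-INDEPENDENT constant — (R1L).  In momentum space ([B5] (1.29)–(1.33),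
this lineage's `dft_sample_apply` ∕ b05 `dft_QsOp` ∕ `dft_LapSinv_apply`) the pairing is `c_Q Σ_{p′} conj β̂(p′) Σ_l a(p′,l) r̂(p′+l)` with the ROW SYMBOL
`a(p′,l) = (e^{i(p′+l)·ηc₀} − u(p′+l))∕Δ(p′+l)²`, while `K₀(β) = ‖Δ⁻¹Q′ᴴβ‖² = c_Q² Σ_{p′} |β̂(p′)|² Σ_l |u(p′+l)|²∕Δ(p′+l)²`; two Cauchy–Schwarz steps (in `l`,
then in `p′`) reduce (R1L) to the per-momentum DISPLAY `Σ_l |a(p′,l)|² ≤ C·Σ_l |u|²∕Δ²` (`p′ ≠ 0`), whose trigonometric form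
`Σ_m (1 − Π_κ F)²∕(Σ_κ S)⁴ ≤ C·Σ_m (Π_κ F)²∕(Σ_κ S)²` is dag-n07-w7 g6's CLAIM-2 `…N07AliasSumRobustBound` (numerically `C*(1,3) = 7.7e−4`, `C*(2,3) = 2.7e−3`,
M-independent).  THIS FILE is the transfer; §4 rewrites the raw row symbol in the real letters of `…OneLevelSymbolBridge` (`|e^{i p·ηc₀} − u(p)| = |1 − Π_ν F_ν|`).

WHAT THIS FILE DOES (namespace `Summit.QuantumFields.YangMills.BalabanUVNodes.N07PointFeasibilityOneLevelRobustBridge`; `n = 2c₀+1` odd, every `d`, `M`;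
`Δ⁻¹ = LapSinv (fine n M) n`, `Q′ = QsOp n M`, `β̂ = dft M β`, `r̂ = dft (fine n M) r`, `p = pOf (l, p′)`).
* §1 `dft_centreSubMean_apply` — the coarse transform of `y ↦ (Δ⁻²r)(ny+c₀) − (Q′Δ⁻²r)(y)` is `c_Q Σ_l a(p′,l)·r̂(p′+l)`, `a = (χ_{p}(ηc₀) − u(p))·Δ(p)⁻¹·Δ(p)⁻¹`.
* §2 bookkeeping: `norm_sum_mul_le` (Cauchy–Schwarz for `Σ a_l b_l` in `ℂ`), `sum_norm_sq_eq_sum_norm_sq_dft` (Parseval, real form; the alias re-indexing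
  `Σ_p = Σ_{p′} Σ_l` is b05's `B5Eq135Momentum.sum_pOf_fibres`, cited), ★ `norm_sq_lapInv_QsOpH_eq_sum` (`‖Δ⁻¹Q′ᴴβ‖² = c_Q² Σ_{p′} |β̂|²·Σ_l |u|²∕|Δ|²`, real form),
  `dft_apply_zero_of_sum_eq_zero` (`β ⊥ 1 ⇒ β̂(0) = 0`).
* §3 ★★★ `robustBound_of_rowSymbol` — for every `C ≥ 0` with the RAW DISPLAY `hA : ∀ p′ ≠ 0, Σ_l ‖χ_p(ηc₀) − u(p)‖²·‖Δ(p)‖⁻⁴ ≤ C·Σ_l ‖u(p)‖²·‖Δ(p)‖⁻²`, every `β` with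
  `Σ_y β(y) = 0` and EVERY fine `r`:  `‖Σ_y conj β(y)·[(Δ⁻²r)(ny+c₀) − (Q′Δ⁻²r)(y)]‖ ≤ √C · √(Σ_x ‖(Δ⁻¹Q′ᴴβ)(x)‖²) · √(Σ_x ‖r(x)‖²)` — (R1L) in x-space
  (no hypothesis on `r`; `M`-uniform iff `C` is).
* §4 ★ `norm_sq_rowSymbol_eq` — the raw row symbol in the real letters of `…OneLevelSymbolBridge`: `‖χ_p(ηc₀) − u(p)‖² = (1 − Π_ν F_ν(p′,l))²` with
  `F_ν = if p′_ν = 0 then δ_{l_ν,0} else sin(ϑ_ν∕2)∕(n sin(ϑ_ν∕2n))`, `ϑ = shiftr` (g0′ `om_pow_mul_conj_vSym`); `norm_lsym_pOf` (`‖Δ(p)‖ = Σ_ν Sxir n ϑ_ν`);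
  ★★ `robustBound_of_gridDisplay` — §3 with the hypothesis in those letters (`Σ_l (1 − ΠF)²∕(ΣSxir)⁴ ≤ C·Σ_l (ΠF)²∕(ΣSxir)²` on the momentum GRID, signed
  representatives `s = sOf M p′ ∈ [−π,π]^d`).
  The DISCHARGE of `hGrid` by dag-n07-w7 g6's `N07AliasSumRobustBound.aliasSum_robust_bound` (p637570; re-indexing `s_ν < 0 ↦ s_ν + 2π`) is the sequel
  `…OneLevelRobust` (FILE 4 of this seat), which states (R1L) in x-space UNCONDITIONALLY for odd `n ≥ 3` with `C(d,n) = (π²∕4)^d(π⁴∕1024 + d²π⁴n^d∕64)`.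

HONEST FRAMING (binding).  Count-neutral helper; finite Fourier bookkeeping (Parseval, Cauchy–Schwarz) on ONE torus at ONE averaging level BY NAME over g0′∕g2's files
(p619405 · p625080 · p626779) and b05's typed letters; the display is a HYPOTHESIS in this file (discharged in the sequel by dag-n07-w7 g6's p637570 with a crude
explicit `C(d,n)`; the numerically sharp `C* ≈ 10⁻³` is located, not typed); nothing of [B11]∕[B6]∕[B5]∕[3]'s analysis is asserted; (L4)'s (S3)–(S5) and `(P)_D` for Bałaban's d = 4 nested
geometries stay OPEN; under road (a) of the K0 lineage nothing here is consumed — located-research insurance for the R0′-native junction.  `hker` at the record ∕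
stub 1 ∕ K0⁷ ∕ K1⁹ NOT closed; N07 NOT discharged; counts unmoved; no summit statement is proved by this seat — R4 closes the conditional finite-𝕋⁴ rung
`BalabanLadder.UV` only; nothing continuum ∕ ℝ⁴ ∕ OS ∕ mass gap ∕ Clay.  No `sorry`, no `def`, no `instance`, no `notation`.
-/

noncomputable section

open scoped BigOperators Matrix ComplexConjugate
open Finset Complex

namespace Summit.QuantumFields.YangMills.BalabanUVNodes.N07PointFeasibilityOneLevelRobustBridge

open Literature.MathematicalPhysics.QuantumFieldTheory.Balaban1983to89
open B5Prop11Plancherel (Tor chi dft fine sOf)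
open B5Block118 (cT cQ cQ_eq bpt pOf pOf_bijective iota om QsOp dft_QsOp chi_pOf_iota)
open B5Prop11Fiber (vSym uSym)
open B5LaplaceInverse (lsym LapSinv)
open B5Momentum130 (dft_zero_apply)
open B5Momentum133 (dft_LapSinv_apply lsym_pOf)
open B5Adjoint130 (dft_QsOp_adjoint)
open N07PointFeasibilityOneLevel (star_dotProduct_eq_dft star_dotProduct_self dft_sample_apply norm_om om_pow_mul_conj_vSym
  om_pow_mul_conj_vSym_zero om_pow_mul_conj_vSym_eq_zero)

variable {d : ℕ} (n : ℕ) [NeZero n] (M : Fin d → ℕ) [hM : ∀ μ, NeZero (M μ)]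

/-! ## §1  The pairing's coarse transform: the row symbol `a(p′,l) = (χ_p(ηc₀) − u(p))·Δ(p)⁻²` -/

section Fourier

/-- ★ **Coarse transform of «centre value minus block mean» of `w = Δ⁻²r`**: `(y ↦ w(ny+c₀) − (Q′w)(y))^(p′) = c_Q Σ_l (χ_{p′+l}(ηc₀) − u(p′+l))·Δ(p′+l)⁻²·r̂(p′+l)`
(`dft_sample_apply`, `dft_QsOp`, `dft_LapSinv_apply` twice). [cite: Balaban1984PropagatorsI, (1.20) p.20, (1.29)-(1.33) p.23; Balaban1987RG1, (0.4) p.253] -/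
theorem dft_centreSubMean_apply (c₀ : Fin d → Fin n) (r : Tor (fine n M) → ℂ) (q : Tor M) :
    (dft M *ᵥ (fun y => (LapSinv (fine n M) (n : ℂ) *ᵥ (LapSinv (fine n M) (n : ℂ) *ᵥ r)) (bpt n M y c₀) -
        (QsOp n M *ᵥ (LapSinv (fine n M) (n : ℂ) *ᵥ (LapSinv (fine n M) (n : ℂ) *ᵥ r))) y)) q
      = (cQ n M : ℂ) * ∑ k : Fin d → Fin n,
          ((chi (fine n M) (pOf n M (k, q)) (iota n M c₀) - uSym n k (sOf M q)) *
            ((lsym (fine n M) (n : ℂ) (pOf n M (k, q)))⁻¹ * (lsym (fine n M) (n : ℂ) (pOf n M (k, q)))⁻¹)) *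
          (dft (fine n M) *ᵥ r) (pOf n M (k, q)) := by
  set w := LapSinv (fine n M) (n : ℂ) *ᵥ (LapSinv (fine n M) (n : ℂ) *ᵥ r) with hw
  have hsplit : (fun y => w (bpt n M y c₀) - (QsOp n M *ᵥ w) y) = (fun y => w (bpt n M y c₀)) - (QsOp n M *ᵥ w) := by
    funext y; rfl
  rw [hsplit, Matrix.mulVec_sub, Pi.sub_apply, dft_sample_apply, dft_QsOp, ← mul_sub, ← Finset.sum_sub_distrib]
  congr 1
  refine Finset.sum_congr rfl fun k _ => ?_
  rw [hw, dft_LapSinv_apply, dft_LapSinv_apply]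
  ring

end Fourier

/-! ## §2  Bookkeeping: Cauchy–Schwarz, Parseval (real form), alias re-indexing, `K₀` in momentum space, `β ⊥ 1 ⇒ β̂(0) = 0` -/

section Bookkeeping

omit hM in
/-- Cauchy–Schwarz in `ℂ`: `‖Σ_i a_i b_i‖ ≤ √(Σ‖a_i‖²)·√(Σ‖b_i‖²)`. [folklore] -/
theorem norm_sum_mul_le {ι : Type*} [Fintype ι] (a b : ι → ℂ) :
    ‖∑ i, a i * b i‖ ≤ Real.sqrt (∑ i, ‖a i‖ ^ 2) * Real.sqrt (∑ i, ‖b i‖ ^ 2) := by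
  have h1 : ‖∑ i, a i * b i‖ ≤ ∑ i, ‖a i‖ * ‖b i‖ :=
    (norm_sum_le _ _).trans (le_of_eq (Finset.sum_congr rfl fun i _ => norm_mul _ _))
  have h2 : (∑ i, ‖a i‖ * ‖b i‖) ^ 2 ≤ (∑ i, ‖a i‖ ^ 2) * ∑ i, ‖b i‖ ^ 2 :=
    Finset.sum_mul_sq_le_sq_mul_sq Finset.univ (fun i => ‖a i‖) (fun i => ‖b i‖)
  have h3 : ∑ i, ‖a i‖ * ‖b i‖ ≤ Real.sqrt (∑ i, ‖a i‖ ^ 2) * Real.sqrt (∑ i, ‖b i‖ ^ 2) := by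
    rw [← Real.sqrt_mul (Finset.sum_nonneg fun i _ => sq_nonneg _)]
    exact Real.le_sqrt_of_sq_le h2
  exact h1.trans h3

/-- Parseval for the unitary DFT of a torus, real form: `Σ_x ‖f(x)‖² = Σ_p ‖f̂(p)‖²`. [folklore] -/
theorem sum_norm_sq_eq_sum_norm_sq_dft {d' : ℕ} (N : Fin d' → ℕ) [∀ μ, NeZero (N μ)] (f : Tor N → ℂ) :
    ∑ x, ‖f x‖ ^ 2 = ∑ p, ‖(dft N *ᵥ f) p‖ ^ 2 := by
  have h := star_dotProduct_eq_dft N f f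
  rw [star_dotProduct_self, star_dotProduct_self] at h
  exact_mod_cast h

/-- ★ **`K₀(β) = ‖Δ⁻¹Q′ᴴβ‖²` in momentum space, real form**: `Σ_x ‖(Δ⁻¹Q′ᴴβ)(x)‖² = Σ_{p′} c_Q²·‖β̂(p′)‖²·Σ_l ‖u(p′+l)‖²·‖Δ(p′+l)‖⁻²`
(Parseval + `dft_LapSinv_apply` + `dft_QsOp_adjoint`). [cite: Balaban1984PropagatorsI, (1.32)-(1.33) p.23; Balaban1984PropagatorsII, (2.22) p.226] -/
theorem norm_sq_lapInv_QsOpH_eq_sum (β : Tor M → ℂ) :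
    ∑ x, ‖(LapSinv (fine n M) (n : ℂ) *ᵥ ((QsOp n M)ᴴ *ᵥ β)) x‖ ^ 2
      = ∑ q : Tor M, (cQ n M) ^ 2 * ‖(dft M *ᵥ β) q‖ ^ 2 *
          ∑ k : Fin d → Fin n, ‖uSym n k (sOf M q)‖ ^ 2 * (‖lsym (fine n M) (n : ℂ) (pOf n M (k, q))‖⁻¹) ^ 2 := by
  rw [sum_norm_sq_eq_sum_norm_sq_dft, B5Eq135Momentum.sum_pOf_fibres n M]
  refine Finset.sum_congr rfl fun q _ => ?_
  rw [Finset.mul_sum]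
  refine Finset.sum_congr rfl fun k _ => ?_
  rw [dft_LapSinv_apply, dft_QsOp_adjoint, norm_mul, norm_mul, norm_mul, norm_inv, Complex.norm_real, RCLike.norm_conj,
    Real.norm_of_nonneg (show 0 ≤ cQ n M by rw [cQ_eq]; positivity)]
  ring

/-- `β ⊥ 1 ⇒ β̂(0) = 0`. [folklore] -/
theorem dft_apply_zero_of_sum_eq_zero (β : Tor M → ℂ) (hβ : ∑ y, β y = 0) : (dft M *ᵥ β) 0 = 0 := by
  rw [dft_zero_apply, hβ, mul_zero]

end Bookkeeping

/-! ## §3  (R1L) in x-space from the raw per-momentum display -/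

section Transfer

/-- ★★★ **THE ROBUST ONE-LEVEL INEQUALITY (R1L), x-SPACE FORM, FROM THE RAW ROW-SYMBOL DISPLAY.**  `n = 2c₀+1` odd (centres `ny + c₀`).  Suppose that for some
`C ≥ 0` and every coarse momentum `p′ ≠ 0`
  `Σ_l ‖χ_{p′+l}(ηc₀) − u(p′+l)‖²·‖Δ(p′+l)‖⁻⁴ ≤ C · Σ_l ‖u(p′+l)‖²·‖Δ(p′+l)‖⁻²`   (`hA`, the row symbol of «centre value minus block mean» against the matched symbol).
Then for every coarse `β` with `Σ_y β(y) = 0` and EVERY fine `r`: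
  `‖Σ_y conj β(y)·[(Δ⁻²r)(ny+c₀) − (Q′Δ⁻²r)(y)]‖ ≤ √C · √(Σ_x ‖(Δ⁻¹Q′ᴴβ)(x)‖²) · √(Σ_x ‖r(x)‖²)`.
Proof: coarse Parseval; §1; Cauchy–Schwarz in `l` for each `p′` (the `p′ = 0` term vanishes with `β̂(0)`); `hA`; Cauchy–Schwarz in `p′`; `norm_sq_lapInv_QsOpH_eq_sum` and fine
Parseval for `r`. [cite: Balaban1984PropagatorsI, (1.29)-(1.33) p.23; Balaban1984PropagatorsII, (2.22) p.226; Balaban1987RG1, (0.4) p.253] -/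
theorem robustBound_of_rowSymbol (c₀ : Fin d → Fin n) {C : ℝ} (hC : 0 ≤ C)
    (hA : ∀ q : Tor M, q ≠ 0 →
      ∑ k : Fin d → Fin n, ‖chi (fine n M) (pOf n M (k, q)) (iota n M c₀) - uSym n k (sOf M q)‖ ^ 2 *
          (‖lsym (fine n M) (n : ℂ) (pOf n M (k, q))‖⁻¹) ^ 4
        ≤ C * ∑ k : Fin d → Fin n, ‖uSym n k (sOf M q)‖ ^ 2 * (‖lsym (fine n M) (n : ℂ) (pOf n M (k, q))‖⁻¹) ^ 2)
    (β : Tor M → ℂ) (hβ : ∑ y, β y = 0) (r : Tor (fine n M) → ℂ) :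
    ‖star β ⬝ᵥ (fun y => (LapSinv (fine n M) (n : ℂ) *ᵥ (LapSinv (fine n M) (n : ℂ) *ᵥ r)) (bpt n M y c₀) -
        (QsOp n M *ᵥ (LapSinv (fine n M) (n : ℂ) *ᵥ (LapSinv (fine n M) (n : ℂ) *ᵥ r))) y)‖
      ≤ Real.sqrt C * Real.sqrt (∑ x, ‖(LapSinv (fine n M) (n : ℂ) *ᵥ ((QsOp n M)ᴴ *ᵥ β)) x‖ ^ 2) *
          Real.sqrt (∑ x, ‖r x‖ ^ 2) := by
  have hcQ : 0 ≤ cQ n M := by rw [cQ_eq]; positivity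
  -- letters
  set D : Tor M → ℂ := fun y => (LapSinv (fine n M) (n : ℂ) *ᵥ (LapSinv (fine n M) (n : ℂ) *ᵥ r)) (bpt n M y c₀) -
      (QsOp n M *ᵥ (LapSinv (fine n M) (n : ℂ) *ᵥ (LapSinv (fine n M) (n : ℂ) *ᵥ r))) y with hD
  set a : Tor M → (Fin d → Fin n) → ℂ := fun q k =>
      (chi (fine n M) (pOf n M (k, q)) (iota n M c₀) - uSym n k (sOf M q)) *
        ((lsym (fine n M) (n : ℂ) (pOf n M (k, q)))⁻¹ * (lsym (fine n M) (n : ℂ) (pOf n M (k, q)))⁻¹) with ha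
  set R : Tor M → ℝ := fun q => Real.sqrt (∑ k : Fin d → Fin n, ‖(dft (fine n M) *ᵥ r) (pOf n M (k, q))‖ ^ 2) with hR
  set X : Tor M → ℝ := fun q =>
      ∑ k : Fin d → Fin n, ‖uSym n k (sOf M q)‖ ^ 2 * (‖lsym (fine n M) (n : ℂ) (pOf n M (k, q))‖⁻¹) ^ 2 with hX
  have hX0 : ∀ q, 0 ≤ X q := fun q => Finset.sum_nonneg fun k _ => by positivity
  have hR0 : ∀ q, 0 ≤ R q := fun q => Real.sqrt_nonneg _
  -- Step 1: coarse Parseval and the triangle inequality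
  have h1 : ‖star β ⬝ᵥ D‖ ≤ ∑ q, ‖(dft M *ᵥ β) q‖ * ‖(dft M *ᵥ D) q‖ := by
    rw [star_dotProduct_eq_dft M β D, dotProduct]
    refine (norm_sum_le _ _).trans (le_of_eq (Finset.sum_congr rfl fun q _ => ?_))
    rw [Pi.star_apply, norm_mul, norm_star]
  -- Step 2: per momentum, §1 and Cauchy–Schwarz in the alias index
  have h2 : ∀ q, ‖(dft M *ᵥ D) q‖ ≤ cQ n M * Real.sqrt (∑ k : Fin d → Fin n, ‖a q k‖ ^ 2) * R q := by
    intro q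
    rw [hD, dft_centreSubMean_apply n M c₀ r q, norm_mul, Complex.norm_real, Real.norm_of_nonneg hcQ, mul_assoc]
    gcongr
    exact norm_sum_mul_le (a q) _
  -- Step 3: the display on `q ≠ 0`; the zero mode of `β` vanishes
  have h3 : ∀ q, ‖(dft M *ᵥ β) q‖ * ‖(dft M *ᵥ D) q‖ ≤
      Real.sqrt C * ((cQ n M * ‖(dft M *ᵥ β) q‖ * Real.sqrt (X q)) * R q) := by
    intro q
    by_cases hq : q = 0
    · rw [hq, dft_apply_zero_of_sum_eq_zero M β hβ, norm_zero, zero_mul, mul_zero, zero_mul, zero_mul, mul_zero]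
    · have hAq : ∑ k : Fin d → Fin n, ‖a q k‖ ^ 2 ≤ C * X q := by
        refine le_of_eq_of_le (Finset.sum_congr rfl fun k _ => ?_) (hA q hq)
        rw [ha]
        simp only [norm_mul, norm_inv]
        ring
      calc ‖(dft M *ᵥ β) q‖ * ‖(dft M *ᵥ D) q‖
          ≤ ‖(dft M *ᵥ β) q‖ * (cQ n M * Real.sqrt (C * X q) * R q) := by
            gcongr
            exact (h2 q).trans (by gcongr)
        _ = Real.sqrt C * ((cQ n M * ‖(dft M *ᵥ β) q‖ * Real.sqrt (X q)) * R q) := by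
            rw [Real.sqrt_mul hC]; ring
  -- Step 4: Cauchy–Schwarz in `p′`
  have h4 : ∑ q, (cQ n M * ‖(dft M *ᵥ β) q‖ * Real.sqrt (X q)) * R q ≤
      Real.sqrt (∑ q, (cQ n M * ‖(dft M *ᵥ β) q‖ * Real.sqrt (X q)) ^ 2) * Real.sqrt (∑ q, R q ^ 2) := by
    rw [← Real.sqrt_mul (Finset.sum_nonneg fun q _ => sq_nonneg _)]
    exact Real.le_sqrt_of_sq_le (Finset.sum_mul_sq_le_sq_mul_sq Finset.univ _ _)
  -- Step 5: identify the two sums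
  have h5 : ∑ q, (cQ n M * ‖(dft M *ᵥ β) q‖ * Real.sqrt (X q)) ^ 2 =
      ∑ x, ‖(LapSinv (fine n M) (n : ℂ) *ᵥ ((QsOp n M)ᴴ *ᵥ β)) x‖ ^ 2 := by
    rw [norm_sq_lapInv_QsOpH_eq_sum n M β]
    refine Finset.sum_congr rfl fun q _ => ?_
    rw [mul_pow, mul_pow, Real.sq_sqrt (hX0 q)]
  have h6 : ∑ q, R q ^ 2 = ∑ x, ‖r x‖ ^ 2 := by
    rw [sum_norm_sq_eq_sum_norm_sq_dft (fine n M) r, B5Eq135Momentum.sum_pOf_fibres n M]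
    exact Finset.sum_congr rfl fun q _ => Real.sq_sqrt (Finset.sum_nonneg fun k _ => sq_nonneg _)
  calc ‖star β ⬝ᵥ D‖ ≤ ∑ q, ‖(dft M *ᵥ β) q‖ * ‖(dft M *ᵥ D) q‖ := h1
    _ ≤ ∑ q, Real.sqrt C * ((cQ n M * ‖(dft M *ᵥ β) q‖ * Real.sqrt (X q)) * R q) := Finset.sum_le_sum fun q _ => h3 q
    _ = Real.sqrt C * ∑ q, (cQ n M * ‖(dft M *ᵥ β) q‖ * Real.sqrt (X q)) * R q := by rw [Finset.mul_sum]
    _ ≤ Real.sqrt C * (Real.sqrt (∑ q, (cQ n M * ‖(dft M *ᵥ β) q‖ * Real.sqrt (X q)) ^ 2) * Real.sqrt (∑ q, R q ^ 2)) := by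
        gcongr
    _ = Real.sqrt C * Real.sqrt (∑ x, ‖(LapSinv (fine n M) (n : ℂ) *ᵥ ((QsOp n M)ᴴ *ᵥ β)) x‖ ^ 2) *
          Real.sqrt (∑ x, ‖r x‖ ^ 2) := by rw [h5, h6, mul_assoc]

end Transfer

/-! ## §4  The row symbol in the real letters of `…OneLevelSymbolBridge`; (R1L) from the GRID display -/

section RealLetters

/-- `Φ·conj u = Π_ν F_ν` (real): the centre phase `Φ = χ_p(ηc₀) = Π_ν ω_ν^{c₀}` times `conj u(p)` is g0′'s real centred factor
(`factor_eq_real` coordinatewise). [cite: Balaban1984PropagatorsI, (1.31) p.23; Balaban1987RG1, (0.4) p.253] -/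
theorem chi_mul_conj_uSym_eq (c₀ : Fin d → Fin n) (hc₀ : ∀ ν, 2 * (c₀ ν : ℕ) + 1 = n) (k : Fin d → Fin n) (q : Tor M) :
    chi (fine n M) (pOf n M (k, q)) (iota n M c₀) * conj (uSym n k (sOf M q))
      = ((∏ ν, (if q ν = 0 then (if k ν = 0 then (1 : ℝ) else 0) else
          Real.sin (B4Strip.shiftr n k (sOf M q) ν / 2) / ((n : ℝ) * Real.sin (B4Strip.shiftr n k (sOf M q) ν / (2 * n)))) : ℝ) : ℂ) := by
  rw [chi_pOf_iota, uSym, map_prod, ← Finset.prod_mul_distrib]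
  simp_rw [N07PointFeasibilityOneLevel.factor_eq_real n M _ (hc₀ _) k q]
  rw [← Complex.ofReal_prod]

/-- `‖χ_p(ηc₀)‖ = 1`. [folklore] -/
theorem norm_chi_pOf_iota (c₀ : Fin d → Fin n) (k : Fin d → Fin n) (q : Tor M) :
    ‖chi (fine n M) (pOf n M (k, q)) (iota n M c₀)‖ = 1 := by
  rw [chi_pOf_iota, norm_prod]
  exact Finset.prod_eq_one fun ν _ => by rw [norm_pow, norm_om, one_pow]

/-- ★ **The row symbol's numerator in real letters**: `‖χ_p(ηc₀) − u(p)‖² = (1 − Π_ν F_ν)²` — since `u(p) = Φ·Π_ν F_ν` with the unimodular centre phase `Φ = χ_p(ηc₀)`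
(print's `u` is the centred Dirichlet factor times the half-block phase, `(n−1)∕2 = c₀`). [cite: Balaban1984PropagatorsI, (1.31) p.23; Balaban1987RG1, (0.4) p.253] -/
theorem norm_sq_rowSymbol_eq (c₀ : Fin d → Fin n) (hc₀ : ∀ ν, 2 * (c₀ ν : ℕ) + 1 = n) (k : Fin d → Fin n) (q : Tor M) :
    ‖chi (fine n M) (pOf n M (k, q)) (iota n M c₀) - uSym n k (sOf M q)‖ ^ 2
      = (1 - ∏ ν, (if q ν = 0 then (if k ν = 0 then (1 : ℝ) else 0) else
          Real.sin (B4Strip.shiftr n k (sOf M q) ν / 2) / ((n : ℝ) * Real.sin (B4Strip.shiftr n k (sOf M q) ν / (2 * n))))) ^ 2 := by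
  set Φ := chi (fine n M) (pOf n M (k, q)) (iota n M c₀) with hΦ
  set u := uSym n k (sOf M q) with hu
  have h1 : ‖Φ‖ = 1 := norm_chi_pOf_iota n M c₀ k q
  have hF := chi_mul_conj_uSym_eq n M c₀ hc₀ k q
  rw [← hΦ, ← hu] at hF
  -- multiply by the unimodular `conj Φ`
  have h2 : ‖Φ - u‖ = ‖conj Φ * (Φ - u)‖ := by rw [norm_mul, RCLike.norm_conj, h1, one_mul]
  have hΦΦ : conj Φ * Φ = 1 := by
    rw [← Complex.normSq_eq_conj_mul_self, Complex.normSq_eq_norm_sq, h1, one_pow, Complex.ofReal_one]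
  have h3 : conj Φ * (Φ - u) = 1 - conj (Φ * conj u) := by
    rw [mul_sub, hΦΦ, map_mul, Complex.conj_conj]
  rw [h2, h3, hF, Complex.conj_ofReal, ← Complex.ofReal_one, ← Complex.ofReal_sub, Complex.norm_real, Real.norm_eq_abs, sq_abs]

/-- `‖u(p)‖² = (Π_ν F_ν)²` (g2's `norm_sq_vSym_eq_factor_sq` coordinatewise). [cite: Balaban1984PropagatorsI, (1.31) p.23] -/
theorem norm_sq_uSym_eq (c₀ : Fin d → Fin n) (hc₀ : ∀ ν, 2 * (c₀ ν : ℕ) + 1 = n) (k : Fin d → Fin n) (q : Tor M) :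
    ‖uSym n k (sOf M q)‖ ^ 2
      = (∏ ν, (if q ν = 0 then (if k ν = 0 then (1 : ℝ) else 0) else
          Real.sin (B4Strip.shiftr n k (sOf M q) ν / 2) / ((n : ℝ) * Real.sin (B4Strip.shiftr n k (sOf M q) ν / (2 * n))))) ^ 2 := by
  rw [uSym, norm_prod, ← Finset.prod_pow, ← Finset.prod_pow]
  exact Finset.prod_congr rfl fun ν _ => N07PointFeasibilityOneLevel.norm_sq_vSym_eq_factor_sq n M (c₀ ν) (hc₀ ν) k q ν

/-- `‖Δ(p′+l)‖ = Σ_ν Sxir n (ϑ_ν)`, `ϑ = shiftr` (the Laplacian symbol is the non-negative real `Σ_ν 4n²sin²(ϑ_ν∕2n)`). [cite: Balaban1984PropagatorsI, (1.31) p.23] -/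
theorem norm_lsym_pOf (k : Fin d → Fin n) (q : Tor M) :
    ‖lsym (fine n M) (n : ℂ) (pOf n M (k, q))‖ = ∑ ν, B4Strip.Sxir n (B4Strip.shiftr n k (sOf M q) ν) := by
  rw [lsym_pOf, Complex.norm_real, Real.norm_of_nonneg]
  · unfold B4Strip.DeltaXir; rw [add_zero]
  · unfold B4Strip.DeltaXir
    rw [add_zero]
    exact Finset.sum_nonneg fun ν _ => B4Strip.Sxir_nonneg n _

/-- ★★ **(R1L) in x-space FROM THE GRID DISPLAY in real letters.**  `n = 2c₀+1` odd; `F_ν(p′,l) = if p′_ν = 0 then δ_{l_ν,0} else sin(ϑ_ν∕2)∕(n sin(ϑ_ν∕2n))`,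
`ϑ_ν = s_ν + 2πl_ν` with the signed representative `s = sOf M p′ ∈ [−π,π]^d`, `S_ν = Sxir n ϑ_ν = 4n²sin²(ϑ_ν∕2n)`.  If for some `C ≥ 0` and every `p′ ≠ 0`
  `Σ_l (1 − Π_ν F_ν)²·((Σ_ν S_ν)⁻¹)⁴ ≤ C·Σ_l (Π_ν F_ν)²·((Σ_ν S_ν)⁻¹)²`   (`hGrid` — dag-n07-w7 g6's display (R1L) read on the momentum grid),
then for every `β ⊥ 1` and every fine `r`: `‖Σ_y conj β(y)·[(Δ⁻²r)(ny+c₀) − (Q′Δ⁻²r)(y)]‖ ≤ √C·‖Δ⁻¹Q′ᴴβ‖·‖r‖`.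
[cite: Balaban1984PropagatorsI, (1.29)-(1.33) p.23; Balaban1984PropagatorsII, (2.22) p.226; Balaban1987RG1, (0.4) p.253] -/
theorem robustBound_of_gridDisplay (c₀ : Fin d → Fin n) (hc₀ : ∀ ν, 2 * (c₀ ν : ℕ) + 1 = n) {C : ℝ} (hC : 0 ≤ C)
    (hGrid : ∀ q : Tor M, q ≠ 0 →
      ∑ k : Fin d → Fin n, (1 - ∏ ν, (if q ν = 0 then (if k ν = 0 then (1 : ℝ) else 0) else
          Real.sin (B4Strip.shiftr n k (sOf M q) ν / 2) / ((n : ℝ) * Real.sin (B4Strip.shiftr n k (sOf M q) ν / (2 * n))))) ^ 2 *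
          ((∑ ν, B4Strip.Sxir n (B4Strip.shiftr n k (sOf M q) ν))⁻¹) ^ 4
        ≤ C * ∑ k : Fin d → Fin n, (∏ ν, (if q ν = 0 then (if k ν = 0 then (1 : ℝ) else 0) else
          Real.sin (B4Strip.shiftr n k (sOf M q) ν / 2) / ((n : ℝ) * Real.sin (B4Strip.shiftr n k (sOf M q) ν / (2 * n))))) ^ 2 *
          ((∑ ν, B4Strip.Sxir n (B4Strip.shiftr n k (sOf M q) ν))⁻¹) ^ 2)
    (β : Tor M → ℂ) (hβ : ∑ y, β y = 0) (r : Tor (fine n M) → ℂ) :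
    ‖star β ⬝ᵥ (fun y => (LapSinv (fine n M) (n : ℂ) *ᵥ (LapSinv (fine n M) (n : ℂ) *ᵥ r)) (bpt n M y c₀) -
        (QsOp n M *ᵥ (LapSinv (fine n M) (n : ℂ) *ᵥ (LapSinv (fine n M) (n : ℂ) *ᵥ r))) y)‖
      ≤ Real.sqrt C * Real.sqrt (∑ x, ‖(LapSinv (fine n M) (n : ℂ) *ᵥ ((QsOp n M)ᴴ *ᵥ β)) x‖ ^ 2) *
          Real.sqrt (∑ x, ‖r x‖ ^ 2) := by
  refine robustBound_of_rowSymbol n M c₀ hC (fun q hq => ?_) β hβ r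
  have h := hGrid q hq
  simp_rw [norm_sq_rowSymbol_eq n M c₀ hc₀, norm_sq_uSym_eq n M c₀ hc₀, norm_lsym_pOf n M]
  exact h

end RealLetters

end Summit.QuantumFields.YangMills.BalabanUVNodes.N07PointFeasibilityOneLevelRobustBridge

end
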